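import Literature.Topology.Immersions.OpenParallelizableImmersionTransport
import Literature.Topology.FourManifolds.SublevelPushDown
import Literature.Topology.FourManifolds.ProperMorseFunction
import HarnessLib

/-!
# Open parallelizable manifolds immerse in `ℝⁿ`: spreading a formal submersion across a slab
# without critical points

Topic `Literature/Topology/Immersions`; part of the proof programme for the named fact
`Literature.Topology.Immersions.Phillips1967_exists_isLocalDiffeomorph_of_isParallelizable`
(Phillips 1967, Cor. 8.2, "if"), in the formal-solution language of
`OpenParallelizableImmersionInduction.lean` (`HolonomicNear σ f Ψ U`).

The induction over the sublevel sets `Mᶜ = {f ≤ c}` of a proper Morse function has two kinds of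
steps; this file proves the easy one (Phillips 1967, §6 with Lemma 4.7: *collar-like*
enlargements; Milnor, *Morse theory* (1963), Thm. 3.1: `Mᵃ` is a deformation retract of `Mᵇ`
when `f⁻¹[a, b]` is compact without critical points): a formal submersion holonomic near `Mᵃ`
is turned into one holonomic near `Mᵇ` by composing with the end of the push-down flow of the
tree (`Literature.Topology.FourManifolds.exists_flow_pushDown`, `SublevelPushDown.lean`), which
carries `Mᵇ` into `Int Mᵃ`; the formal derivative is transported along the flow by
`HolonomicNear.transport` (`OpenParallelizableImmersionTransport.lean`).

* `Literature.Topology.Immersions.HolonomicNear.pushDown` — for any smooth `F : M → ℝ` with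
  `F⁻¹[a - 2δ, b + 3δ]` compact and free of critical points: holonomic near `{F ≤ a}` ⟹
  holonomic near `{F ≤ b}`, the map being unchanged where `F ≤ a - 2δ` or `b + 3δ ≤ F`.
* `Literature.Topology.Immersions.HolonomicNear.pushDown_of_isMorse` — the same for a proper
  Morse function `f` and levels `a ≤ b` with no critical point in `f⁻¹[a, b]`, the map being
  unchanged on `{f ≤ γ}` for any prescribed `γ < a` (critical values below `b + 1` are finite,
  so a thin enough slab around `[a, b]` is still free of critical points).

Everything is **proved**; no definitions, no named facts.

## References

* A. Phillips, *Submersions of open manifolds*, Topology **6** (1967), 171–206: Def. p. 176,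
  Lemma 4.7, §6. [Phillips1967]
* J. Milnor, *Morse theory*, Ann. of Math. Studies 51 (1963), Thm. 3.1. [Milnor1963]
-/

open scoped Manifold ContDiff Topology
open Set Function Filter

noncomputable section

namespace Literature.Topology.Immersions

open Literature.Topology.FourManifolds

/-- Local notation: `𝔼 n` is the model Euclidean space `EuclideanSpace ℝ (Fin n)`. -/
local notation "𝔼 " n:arg => EuclideanSpace ℝ (Fin n)

variable {n : ℕ} {M : Type*} [TopologicalSpace M] [ChartedSpace (𝔼 n) M] [IsManifold (𝓡 n) ∞ M]
  [T2Space M] [SigmaCompactSpace M] {σ : Fin n → M → 𝔼 n}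

/-- **Spreading a formal submersion across a slab without critical points** (Phillips 1967,
§6 with Lemma 4.7; Milnor 1963, Thm. 3.1). Let `σ` be a continuous frame of `M`, `F : M → ℝ`
smooth, `a ≤ b`, `δ > 0`, with `F⁻¹[a - 2δ, b + 3δ]` compact and free of critical points. If
the formal submersion `(g, Ψ)` is holonomic near `{F ≤ a}`, then there is a formal submersion
`(g', Ψ')` holonomic near `{F ≤ b}` with `g' = g` wherever `F ≤ a - 2δ` or `b + 3δ ≤ F`:
`g' = g ∘ Θ₁` for the push-down flow `Θ` (`exists_flow_pushDown`, which carries `{F ≤ b + δ}`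
into `{F ≤ a - δ}` and is stationary off the slab), the formal derivative being transported by
`HolonomicNear.transport`. [cite: Phillips1967, Lemma 4.7 and §6] -/
theorem HolonomicNear.pushDown
    (hσ : ∀ i, Continuous fun x => (⟨x, σ i x⟩ : TangentBundle (𝓡 n) M))
    (hli : ∀ x, LinearIndependent ℝ fun i => σ i x) {F : M → ℝ}
    (hF : ContMDiff (𝓡 n) 𝓘(ℝ, ℝ) ∞ F) {a b δ : ℝ} (hab : a ≤ b) (hδ : 0 < δ)
    (hcpt : IsCompact (F ⁻¹' Icc (a - 2 * δ) (b + 3 * δ)))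
    (hreg : ∀ x, F x ∈ Icc (a - 2 * δ) (b + 3 * δ) → ¬ IsMCriticalPt (𝓡 n) F x)
    {g : M → 𝔼 n} {Ψ : M → Fin n → 𝔼 n} (h : HolonomicNear σ g Ψ (F ⁻¹' Iic a)) :
    ∃ (g' : M → 𝔼 n) (Ψ' : M → Fin n → 𝔼 n), HolonomicNear σ g' Ψ' (F ⁻¹' Iic b) ∧
      (∀ x, F x ≤ a - 2 * δ → g' x = g x) ∧ (∀ x, b + 3 * δ ≤ F x → g' x = g x) := by
  -- the push-down flow for the levels `a ≤ b + δ`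
  have hab' : a ≤ b + δ := by linarith
  have hslab : b + δ + 2 * δ = b + 3 * δ := by ring
  obtain ⟨Θ, hΘ, hΘ0, -, hinv, -, hpush, hfixlo, hfixhi⟩ :=
    exists_flow_pushDown (I := 𝓡 n) hF hab' hδ (by rwa [hslab]) (by rwa [hslab])
  -- transport along `Θ` with the constant cut-off `τ = 1` on `W = {F < b + δ}`
  have hW : IsOpen (F ⁻¹' Iio (b + δ)) := isOpen_Iio.preimage hF.continuous
  obtain ⟨Ψ', hΨ'⟩ := h.transport hσ hli hΘ (fun s _ x => hinv s x) (τ := fun _ => (1 : ℝ))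
    contMDiff_const (fun _ => ⟨zero_le_one, le_rfl⟩) hW (fun _ _ => rfl)
    (fun x hx => (hpush x (le_of_lt hx)).trans (by linarith))
  refine ⟨fun x => g (Θ (1, x)), Ψ', hΨ'.mono fun x hx => ?_, fun x hx => ?_, fun x hx => ?_⟩
  · exact lt_of_le_of_lt (show F x ≤ b from hx) (by linarith)
  · show g (Θ (1, x)) = g x
    rw [hfixlo 1 x hx]
  · show g (Θ (1, x)) = g x
    rw [hfixhi 1 x (by linarith [hx])]

/-- **The regular step of the induction over a proper Morse function** (Phillips 1967, §6:
between consecutive critical levels the manifolds `Mᶜ` only grow by collars). Let `f` be a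
proper Morse function on `M`, `a ≤ b` levels with no critical point in `f⁻¹[a, b]`, and
`γ < a`. A formal submersion holonomic near `Mᵃ` can be replaced by one holonomic near `Mᵇ`
with the same map on `M^γ`. Indeed the critical points below `b + 1` are finitely many
(`finite_criticalSet_inter_of_isCompact_of_isMorse`), so some slab `f⁻¹[a - 2δ, b + 3δ]`,
`0 < δ ≤ (a - γ)/2`, is still compact and free of critical points, and `HolonomicNear.pushDown`
applies. [cite: Phillips1967, §6 (with Lemma 4.7)] -/
theorem HolonomicNear.pushDown_of_isMorse
    (hσ : ∀ i, Continuous fun x => (⟨x, σ i x⟩ : TangentBundle (𝓡 n) M))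
    (hli : ∀ x, LinearIndependent ℝ fun i => σ i x) {f : M → ℝ} (hf : IsMorse (𝓡 n) f)
    (hprop : Tendsto f (cocompact M) atTop) {a b γ : ℝ} (hab : a ≤ b) (hγ : γ < a)
    (hreg : ∀ x, f x ∈ Icc a b → ¬ IsMCriticalPt (𝓡 n) f x)
    {g : M → 𝔼 n} {Ψ : M → Fin n → 𝔼 n} (h : HolonomicNear σ g Ψ (f ⁻¹' Iic a)) :
    ∃ (g' : M → 𝔼 n) (Ψ' : M → Fin n → 𝔼 n), HolonomicNear σ g' Ψ' (f ⁻¹' Iic b) ∧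
      ∀ x, f x ≤ γ → g' x = g x := by
  -- sublevel sets are compact
  have hK : ∀ c, IsCompact (f ⁻¹' Iic c) := fun c => by
    rw [(hasBasis_cocompact (X := M)).tendsto_iff atTop_basis] at hprop
    obtain ⟨K, hKc, hKf⟩ := hprop (c + 1) trivial
    refine hKc.of_isClosed_subset (isClosed_Iic.preimage hf.1.continuous) fun x hx => ?_
    by_contra hxK
    have h1 : c + 1 ≤ f x := hKf x hxK
    have h2 : f x ≤ c := hx
    linarith
  -- finitely many critical values below `b + 1`; those are at positive distance from `[a, b]`
  have hfin : (f '' (criticalSet (𝓡 n) f ∩ f ⁻¹' Iic (b + 1))).Finite :=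
    (finite_criticalSet_inter_of_isCompact_of_isMorse hf (hK (b + 1))).image f
  obtain ⟨δ, hδ, hδγ, hδ1, hδfree⟩ : ∃ δ : ℝ, 0 < δ ∧ 2 * δ ≤ a - γ ∧ 3 * δ ≤ 1 ∧
      ∀ v ∈ f '' (criticalSet (𝓡 n) f ∩ f ⁻¹' Iic (b + 1)), v ∉ Icc (a - 2 * δ) (b + 3 * δ) := by
    set S := hfin.toFinset with hS
    -- every critical value below `b + 1` lies off `[a, b]`
    have hside : ∀ v ∈ S, 0 < max (a - v) (v - b) := by
      intro v hv
      rw [hS, Finite.mem_toFinset] at hv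
      obtain ⟨x, ⟨hxc, -⟩, rfl⟩ := hv
      rw [mem_criticalSet] at hxc
      by_contra hle
      rw [not_lt, max_le_iff] at hle
      exact hreg x ⟨by linarith [hle.1], by linarith [hle.2]⟩ hxc
    -- a uniform gap `d`
    obtain ⟨d, hd, hdS⟩ : ∃ d : ℝ, 0 < d ∧ ∀ v ∈ S, v ≤ a - d ∨ b + d ≤ v := by
      by_cases hne : S.Nonempty
      · obtain ⟨v₀, hv₀, hdv₀⟩ := Finset.exists_mem_eq_inf' hne fun v => max (a - v) (v - b)
        refine ⟨S.inf' hne fun v => max (a - v) (v - b), by rw [hdv₀]; exact hside v₀ hv₀,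
          fun v hv => ?_⟩
        have hle : (S.inf' hne fun v => max (a - v) (v - b)) ≤ max (a - v) (v - b) :=
          Finset.inf'_le _ hv
        rcases le_max_iff.1 hle with h1 | h1
        · left; linarith
        · right; linarith
      · exact ⟨1, one_pos, fun v hv => absurd ⟨v, hv⟩ hne⟩
    refine ⟨min (min (d / 4) ((a - γ) / 2)) (1 / 3), by positivity, ?_, ?_, ?_⟩
    · linarith [min_le_left (min (d / 4) ((a - γ) / 2)) (1 / 3),
        min_le_right (d / 4) ((a - γ) / 2)]
    · linarith [min_le_right (min (d / 4) ((a - γ) / 2)) (1 / 3)]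
    · intro v hv hvI
      have hvS : v ∈ S := by rw [hS, Finite.mem_toFinset]; exact hv
      have hδd : min (min (d / 4) ((a - γ) / 2)) (1 / 3) ≤ d / 4 :=
        (min_le_left _ _).trans (min_le_left _ _)
      rcases hdS v hvS with h1 | h1
      · linarith [hvI.1]
      · linarith [hvI.2]
  -- the slab `[a - 2δ, b + 3δ]` is compact and free of critical points
  have hcpt : IsCompact (f ⁻¹' Icc (a - 2 * δ) (b + 3 * δ)) :=
    (hK (b + 3 * δ)).of_isClosed_subset (isClosed_Icc.preimage hf.1.continuous)
      fun x hx => hx.2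
  have hreg' : ∀ x, f x ∈ Icc (a - 2 * δ) (b + 3 * δ) → ¬ IsMCriticalPt (𝓡 n) f x := by
    intro x hx hxc
    refine hδfree (f x) ⟨x, ⟨(mem_criticalSet).2 hxc, ?_⟩, rfl⟩ hx
    show f x ≤ b + 1
    linarith [hx.2]
  obtain ⟨g', Ψ', hg', hlo, -⟩ := h.pushDown hσ hli hf.1 hab hδ hcpt hreg'
  exact ⟨g', Ψ', hg', fun x hx => hlo x (by linarith)⟩

end Literature.Topology.Immersions
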